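import Literature.Probability.RandomPlanarGeometry.CollarDomain
import HarnessLib

/-!
# Uniform local connectedness of the collar boundaries

Topic `Literature/Probability/RandomPlanarGeometry`; family `conformal-planar`. The boundary loops
`t ↦ tube (profile σ h t) t` of the collar domains `collarRect R T σ h` (`CollarDomain.lean`) are
uniformly locally connected *uniformly in the sign pattern `σ` and the width `h ≤ 1/2`*: close
boundary points have close parameters modulo the period (`exists_param_close_of_dist_lt`, from the
injectivity of the tube on a compact set), and parameter intervals of small length have images of
small diameter (`exists_dist_boundary_lt_of_abs_sub_le`, from the uniform continuity of the tube
and the uniform equicontinuity of the profiles). This is the function `r(Γ, ε)` of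
Bollobás–Riordan, *Percolation* (2006), Ch. 7 Lemma 15 p. 185 ("any two points of `Γ` at distance
`< r` are joined by an arc of `Γ` of diameter `< ε`"), made uniform over the family of collar
curves.

## References

* B. Bollobás, O. Riordan, *Percolation*, Cambridge University Press (2006), Ch. 7 Lemma 15 p. 185.

## Mathlib / tree

Mathlib: `IsCompact.exists_isMinOn`, `IsCompact.uniformContinuousOn_of_continuous`,
`ContinuousOn.comp_fract''`. Tree: `CollarDomain`, `ConformalTube`.
-/

noncomputable section

open Set Metric Topology Filter

namespace Literature.Probability.RandomPlanarGeometry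

namespace MarkedDomain

variable (R : ConformalRectangle) (T : R.toJordanDomain.TubeData)

/-- **Close tube points have close parameters modulo the period.** For `0 < λ ≤ 1/2` there is
`η₁ > 0` such that two tube points at levels in `[1/2, 3/2]` and parameters in `[0, 1]` at distance
`< η₁` have parameters differing by `< λ` or by `> 1 - λ`. [folklore] -/
theorem exists_param_close_of_dist_lt {lam : ℝ} (hlam : 0 < lam) (hlam1 : lam ≤ 1 / 2) :
    ∃ η₁ > 0, ∀ s t s' t' : ℝ, s ∈ Icc (1 / 2 : ℝ) (3 / 2) → s' ∈ Icc (1 / 2 : ℝ) (3 / 2) → t ∈ Icc (0 : ℝ) 1 → t' ∈ Icc (0 : ℝ) 1 →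
      dist (T.tube s t) (T.tube s' t') < η₁ → |t - t'| < lam ∨ 1 - lam < |t - t'| := by
  -- the compact set of pairs with `λ ≤ |t - t'| ≤ 1 - λ`
  set K : Set ((ℝ × ℝ) × (ℝ × ℝ)) := {q | q.1 ∈ Icc (1 / 2 : ℝ) (3 / 2) ×ˢ Icc (0 : ℝ) 1 ∧ q.2 ∈ Icc (1 / 2 : ℝ) (3 / 2) ×ˢ Icc (0 : ℝ) 1 ∧
    lam ≤ |q.1.2 - q.2.2| ∧ |q.1.2 - q.2.2| ≤ 1 - lam} with hK
  have hKc : IsCompact K := by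
    have hbig : IsCompact ((Icc (1 / 2 : ℝ) (3 / 2) ×ˢ Icc (0 : ℝ) 1) ×ˢ (Icc (1 / 2 : ℝ) (3 / 2) ×ˢ Icc (0 : ℝ) 1)) :=
      ((isCompact_Icc).prod isCompact_Icc).prod ((isCompact_Icc).prod isCompact_Icc)
    refine hbig.of_isClosed_subset ?_ fun q hq => ⟨hq.1, hq.2.1⟩
    have hc : Continuous fun q : (ℝ × ℝ) × (ℝ × ℝ) => |q.1.2 - q.2.2| := by fun_prop
    refine ((isClosed_Icc.prod isClosed_Icc).preimage continuous_fst).inter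
      (((isClosed_Icc.prod isClosed_Icc).preimage continuous_snd).inter
        ((isClosed_le continuous_const hc).inter (isClosed_le hc continuous_const)))
  set f : (ℝ × ℝ) × (ℝ × ℝ) → ℝ := fun q => dist (T.tube q.1.1 q.1.2) (T.tube q.2.1 q.2.2) with hf
  have hfc : ContinuousOn f K := by
    have h1 : ContinuousOn (fun q : (ℝ × ℝ) × (ℝ × ℝ) => T.tube q.1.1 q.1.2) K :=
      T.continuousOn_tube.comp continuous_fst.continuousOn fun q hq => ⟨by linarith [hq.1.1.1], by linarith [hq.1.1.2]⟩
    have h2 : ContinuousOn (fun q : (ℝ × ℝ) × (ℝ × ℝ) => T.tube q.2.1 q.2.2) K :=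
      T.continuousOn_tube.comp continuous_snd.continuousOn fun q hq => ⟨by linarith [hq.2.1.1.1], by linarith [hq.2.1.1.2]⟩
    exact continuous_dist.comp_continuousOn (h1.prodMk h2)
  -- `f` is positive on `K`
  have hfpos : ∀ q ∈ K, 0 < f q := by
    rintro ⟨⟨s, t⟩, ⟨s', t'⟩⟩ ⟨⟨hs, ht⟩, ⟨hs', ht'⟩, hl, hu⟩
    simp only at hs ht hs' ht' hl hu ⊢
    refine dist_pos.2 fun he => ?_
    -- reduce `t = 1`, `t' = 1` to `0` and use injectivity on `[0, 1)`
    have key : ∀ {a b a' b' : ℝ}, a ∈ Icc (1 / 2 : ℝ) (3 / 2) → a' ∈ Icc (1 / 2 : ℝ) (3 / 2) → b ∈ Ico (0 : ℝ) 1 → b' ∈ Ico (0 : ℝ) 1 →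
        T.tube a b = T.tube a' b' → b = b' := by
      intro a b a' b' ha ha' hb hb' h
      have hinj := T.injOn_tube
      have := hinj (show ((a, b) : ℝ × ℝ) ∈ {q : ℝ × ℝ | 0 < q.1 ∧ q.1 < 2 ∧ q.2 ∈ Ico (0 : ℝ) 1} from
          ⟨by linarith [ha.1], by linarith [ha.2], hb⟩)
        (show ((a', b') : ℝ × ℝ) ∈ {q : ℝ × ℝ | 0 < q.1 ∧ q.1 < 2 ∧ q.2 ∈ Ico (0 : ℝ) 1} from
          ⟨by linarith [ha'.1], by linarith [ha'.2], hb'⟩) h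
      exact congrArg Prod.snd this
    have h01 : T.tube s' 1 = T.tube s' 0 := by have := R.tube_add_one T s' 0; rwa [zero_add] at this
    have h01' : T.tube s 1 = T.tube s 0 := by have := R.tube_add_one T s 0; rwa [zero_add] at this
    by_cases hlt : t < 1 <;> by_cases hlt' : t' < 1
    · have := key hs hs' ⟨ht.1, hlt⟩ ⟨ht'.1, hlt'⟩ he
      rw [this, sub_self, abs_zero] at hl; linarith
    · have ht1 : t' = 1 := le_antisymm ht'.2 (not_lt.1 hlt')
      rw [ht1, h01] at he
      have := key hs hs' ⟨ht.1, hlt⟩ ⟨le_rfl, one_pos⟩ he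
      rw [this, ht1] at hu; norm_num at hu; linarith
    · have ht1 : t = 1 := le_antisymm ht.2 (not_lt.1 hlt)
      rw [ht1, h01'] at he
      have := key hs hs' ⟨le_rfl, one_pos⟩ ⟨ht'.1, hlt'⟩ he
      rw [← this, ht1] at hu; norm_num at hu; linarith
    · have ht1 : t = 1 := le_antisymm ht.2 (not_lt.1 hlt)
      have ht1' : t' = 1 := le_antisymm ht'.2 (not_lt.1 hlt')
      rw [ht1, ht1', sub_self, abs_zero] at hl; linarith
  rcases K.eq_empty_or_nonempty with hKe | hKne
  · refine ⟨1, one_pos, fun s t s' t' hs hs' ht ht' _ => ?_⟩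
    by_contra hno
    push Not at hno
    have : ((s, t), (s', t')) ∈ K := ⟨⟨hs, ht⟩, ⟨hs', ht'⟩, hno.1, hno.2⟩
    rw [hKe] at this; exact this
  · obtain ⟨q₀, hq₀, hmin⟩ := hKc.exists_isMinOn hKne hfc
    refine ⟨f q₀, hfpos q₀ hq₀, fun s t s' t' hs hs' ht ht' hd => ?_⟩
    by_contra hno
    push Not at hno
    have hmem : ((s, t), (s', t')) ∈ K := ⟨⟨hs, ht⟩, ⟨hs', ht'⟩, hno.1, hno.2⟩
    have h1 : f q₀ ≤ f ((s, t), (s', t')) := hmin hmem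
    have h2 : f ((s, t), (s', t')) = dist (T.tube s t) (T.tube s' t') := rfl
    linarith

/-- The window bump `bumpᵢ (mark 0 + fract (t - mark 0))`: a continuous `1`-periodic function.
[folklore] -/
def windowBump (i : Fin 4) (t : ℝ) : ℝ := bump (R.mark i) (R.nextMark i) (R.mark 0 + Int.fract (t - R.mark 0))

/-- The window bump is continuous. [folklore] -/
theorem continuous_windowBump (i : Fin 4) : Continuous (R.windowBump i) := by
  have hF : Continuous ((fun x => bump (R.mark i) (R.nextMark i) (R.mark 0 + x)) ∘ Int.fract) := by
    refine ContinuousOn.comp_fract'' ((continuous_bump _ _).comp (continuous_const.add continuous_id)).continuousOn ?_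
    simp only [add_zero]
    rw [bump_eq_zero (R.mark_lt_nextMark i).le (Or.inl (R.mark_zero_le_mark i).1),
      bump_eq_zero (R.mark_lt_nextMark i).le (Or.inr (R.mark_zero_le_mark i).2)]
  exact hF.comp (continuous_id.sub continuous_const)

/-- The window bump is `1`-periodic. [folklore] -/
theorem periodic_windowBump (i : Fin 4) : Function.Periodic (R.windowBump i) 1 := fun t => by
  simp only [windowBump, show t + 1 - R.mark 0 = t - R.mark 0 + 1 by ring, Int.fract_add_one]

/-- The profile in terms of the window bumps. [folklore] -/
theorem profile_eq_windowBump (σ : Fin 4 → ℝ) (h t : ℝ) : R.profile σ h t = 1 + h * ∑ i, σ i * R.windowBump i t := rfl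

/-- **Uniform equicontinuity of the profiles**: for `μ > 0` there is `λ > 0` such that
`|t - t'| < λ` implies `|profile σ h t - profile σ h t'| < μ` for all `|σᵢ| ≤ 1`, `0 ≤ h ≤ 1/2`.
[folklore] -/
theorem exists_abs_profile_sub_lt {μ : ℝ} (hμ : 0 < μ) :
    ∃ lam > 0, ∀ (σ : Fin 4 → ℝ), (∀ i, |σ i| ≤ 1) → ∀ h : ℝ, 0 ≤ h → h ≤ 1 / 2 → ∀ t t' : ℝ, |t - t'| < lam →
      |R.profile σ h t - R.profile σ h t'| < μ := by
  -- uniform continuity of each window bump (continuous and periodic: on the compact `[-1, 3]`)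
  have huc : ∀ i : Fin 4, ∃ lam > 0, lam ≤ 1 ∧ ∀ t t' : ℝ, |t - t'| < lam → |R.windowBump i t - R.windowBump i t'| < μ / 2 := by
    intro i
    obtain ⟨l, hl, h⟩ := Metric.uniformContinuousOn_iff.1
      ((isCompact_Icc (a := (-1 : ℝ)) (b := 3)).uniformContinuousOn_of_continuous (R.continuous_windowBump i).continuousOn) (μ / 2) (by positivity)
    refine ⟨min l 1, lt_min hl one_pos, min_le_right _ _, fun t t' hd => ?_⟩
    -- shift both parameters by `-⌊t⌋`
    have e1 : R.windowBump i t = R.windowBump i (Int.fract t) := by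
      rw [← (R.periodic_windowBump i).int_mul (-⌊t⌋) t]; congr 1; rw [Int.fract]; push_cast; ring
    have e2 : R.windowBump i t' = R.windowBump i (t' - ⌊t⌋) := by
      rw [← (R.periodic_windowBump i).int_mul (-⌊t⌋) t']; congr 1; push_cast; ring
    rw [e1, e2]
    have h0 := Int.fract_nonneg t; have h1 := Int.fract_lt_one t
    have hd' : |Int.fract t - (t' - ⌊t⌋)| < min l 1 := by rw [Int.fract]; rwa [show t - ⌊t⌋ - (t' - ⌊t⌋) = t - t' by ring]
    have hd1 : |Int.fract t - (t' - ⌊t⌋)| < 1 := hd'.trans_le (min_le_right _ _)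
    have := abs_lt.1 hd1
    have := h (Int.fract t) ⟨by linarith, by linarith⟩ (t' - ⌊t⌋) ⟨by linarith, by linarith⟩
      (by rw [Real.dist_eq]; exact hd'.trans_le (min_le_left _ _))
    rwa [Real.dist_eq] at this
  choose lam hlam hlam1 hlamuc using huc
  set L := min (min (lam 0) (lam 1)) (min (lam 2) (lam 3)) with hL
  have hL0 : 0 < L := by simp only [hL, lt_min_iff]; exact ⟨⟨hlam 0, hlam 1⟩, hlam 2, hlam 3⟩
  have hLle : ∀ i, L ≤ lam i := by intro i; fin_cases i <;> simp [hL]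
  refine ⟨L, hL0, fun σ hσ h hh0 hh1 t t' hd => ?_⟩
  have hAB : (∑ i, σ i * R.windowBump i t) - (∑ i, σ i * R.windowBump i t') = ∑ i, σ i * (R.windowBump i t - R.windowBump i t') := by
    rw [← Finset.sum_sub_distrib]; exact Finset.sum_congr rfl fun i _ => by ring
  rw [R.profile_eq_windowBump, R.profile_eq_windowBump, show (1 + h * ∑ i, σ i * R.windowBump i t) - (1 + h * ∑ i, σ i * R.windowBump i t') =
    h * ((∑ i, σ i * R.windowBump i t) - (∑ i, σ i * R.windowBump i t')) by ring, hAB]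
  have hterm : ∀ i, |σ i * (R.windowBump i t - R.windowBump i t')| < μ / 2 := fun i => by
    rw [abs_mul]
    have h1 := hlamuc i t t' (hd.trans_le (hLle i))
    have := mul_le_of_le_one_left (abs_nonneg (R.windowBump i t - R.windowBump i t')) (hσ i)
    linarith
  have hsum : |∑ i, σ i * (R.windowBump i t - R.windowBump i t')| < 2 * μ := by
    refine (Finset.abs_sum_le_sum_abs _ _).trans_lt ?_
    rw [Fin.sum_univ_four]; linarith [hterm 0, hterm 1, hterm 2, hterm 3]
  rw [abs_mul, abs_of_nonneg hh0]
  nlinarith [abs_nonneg (∑ i, σ i * (R.windowBump i t - R.windowBump i t'))]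

/-- **Short parameter intervals have small images, uniformly**: for `γ > 0` there is
`λ ∈ (0, 1/2]` such that `|t - t'| ≤ λ` implies `dist (∂D_σ,h(t), ∂D_σ,h(t')) < γ` for every
sign pattern `|σᵢ| ≤ 1` and width `0 < h ≤ 1/2`. [cite: BollobasRiordan2006, Ch. 7 Lemma 15 p. 185] -/
theorem exists_dist_boundary_lt_of_abs_sub_le {γ : ℝ} (hγ : 0 < γ) :
    ∃ lam > 0, lam ≤ 1 / 2 ∧ ∀ (σ : Fin 4 → ℝ) (hσ : ∀ i, |σ i| ≤ 1) (h : ℝ) (hh : 0 < h) (hh1 : h ≤ 1 / 2) (t t' : ℝ),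
      |t - t'| ≤ lam → dist ((R.collarRect T hσ hh hh1).boundary t) ((R.collarRect T hσ hh hh1).boundary t') < γ := by
  -- uniform continuity of the tube on the compact `[1/2, 3/2] × [-1, 2]`
  set K : Set (ℝ × ℝ) := Icc (1 / 2 : ℝ) (3 / 2) ×ˢ Icc (-1 : ℝ) 2 with hK
  have hKc : IsCompact K := isCompact_Icc.prod isCompact_Icc
  have hcont : ContinuousOn (fun q : ℝ × ℝ => T.tube q.1 q.2) K :=
    T.continuousOn_tube.mono fun q hq => ⟨by linarith [hq.1.1], by linarith [hq.1.2]⟩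
  obtain ⟨μ, hμ, huc⟩ := Metric.uniformContinuousOn_iff.1 (hKc.uniformContinuousOn_of_continuous hcont) γ hγ
  obtain ⟨l, hl, hprof⟩ := R.exists_abs_profile_sub_lt hμ
  refine ⟨min (min (l / 2) (μ / 2)) (1 / 2), by positivity, min_le_right _ _, fun σ hσ h hh hh1 t t' hd => ?_⟩
  have hm1 : min (min (l / 2) (μ / 2)) (1 / 2) ≤ l / 2 := (min_le_left _ _).trans (min_le_left _ _)
  have hm2 : min (min (l / 2) (μ / 2)) (1 / 2) ≤ μ / 2 := (min_le_left _ _).trans (min_le_right _ _)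
  have hdl : |t - t'| < l := by linarith [hd.trans hm1]
  have hdμ : |t - t'| < μ := by linarith [hd.trans hm2]
  have hd1 : |t - t'| ≤ 1 / 2 := hd.trans (min_le_right _ _)
  -- shift both parameters by `-⌊t⌋`
  set C := R.collarRect T hσ hh hh1 with hC
  have e1 : C.boundary t = C.boundary (t - ⌊t⌋) := by
    rw [← C.periodic_boundary.int_mul (-⌊t⌋) t]; congr 1; push_cast; ring
  have e2 : C.boundary t' = C.boundary (t' - ⌊t⌋) := by
    rw [← C.periodic_boundary.int_mul (-⌊t⌋) t']; congr 1; push_cast; ring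
  rw [e1, e2, collarRect_boundary, collarRect_boundary]
  have h0 : (0 : ℝ) ≤ t - ⌊t⌋ := by linarith [Int.floor_le t]
  have h1 : t - ⌊t⌋ < 1 := by linarith [Int.lt_floor_add_one t]
  have := abs_le.1 hd1
  have hp1 := R.profile_mem hσ hh (t - ⌊t⌋)
  have hp2 := R.profile_mem hσ hh (t' - ⌊t⌋)
  refine huc (R.profile σ h (t - ⌊t⌋), t - ⌊t⌋) ⟨⟨by linarith [hp1.1], by linarith [hp1.2]⟩, by linarith, by linarith⟩
    (R.profile σ h (t' - ⌊t⌋), t' - ⌊t⌋) ⟨⟨by linarith [hp2.1], by linarith [hp2.2]⟩, by linarith, by linarith⟩ ?_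
  rw [Prod.dist_eq, max_lt_iff, Real.dist_eq, Real.dist_eq]
  refine ⟨hprof σ hσ h hh.le hh1 _ _ ?_, ?_⟩
  · rwa [show t - ⌊t⌋ - (t' - ⌊t⌋) = t - t' by ring]
  · rwa [show t - ⌊t⌋ - (t' - ⌊t⌋) = t - t' by ring]

/-- **Close boundary points of a collar domain have close parameters modulo the period**, uniformly
in the sign pattern and the width: the instance of `exists_param_close_of_dist_lt` for the collar
boundary `t ↦ tube (profile t) t`. [cite: BollobasRiordan2006, Ch. 7 Lemma 15 p. 185] -/
theorem exists_param_close_boundary {lam : ℝ} (hlam : 0 < lam) (hlam1 : lam ≤ 1 / 2) :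
    ∃ η₁ > 0, ∀ (σ : Fin 4 → ℝ) (hσ : ∀ i, |σ i| ≤ 1) (h : ℝ) (hh : 0 < h) (hh1 : h ≤ 1 / 2) (t t' : ℝ),
      t ∈ Icc (0 : ℝ) 1 → t' ∈ Icc (0 : ℝ) 1 →
      dist ((R.collarRect T hσ hh hh1).boundary t) ((R.collarRect T hσ hh hh1).boundary t') < η₁ → |t - t'| < lam ∨ 1 - lam < |t - t'| := by
  obtain ⟨η₁, hη₁, h⟩ := R.exists_param_close_of_dist_lt T hlam hlam1
  refine ⟨η₁, hη₁, fun σ hσ hh0 hh hh1 t t' ht ht' hd => ?_⟩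
  rw [collarRect_boundary, collarRect_boundary] at hd
  have hp1 := R.profile_mem hσ hh t
  have hp2 := R.profile_mem hσ hh t'
  exact h _ _ _ _ ⟨by linarith [hp1.1], by linarith [hp1.2]⟩ ⟨by linarith [hp2.1], by linarith [hp2.2]⟩ ht ht' hd

end MarkedDomain

end Literature.Probability.RandomPlanarGeometry
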